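import Mathlib
import HarnessLib

/-!
# Polar factorisation of a radially weighted Haar measure: the direction is uniform on the sphere and independent of the radius

HONEST FRAMING: exact (Metropolis-corrected) sampling algorithms for lattice gauge theory;
figures of merit are autocorrelation/cost numbers at stated couplings and volumes; no
continuum-physics claim.

Venture `LatticeQCDFlow` (cell pub-lqcd), topic `Exactness`, FANOUT row 9 (eng-latcore, the
engine `latflow.core`).  NEW WORK of the cell over Mathlib's polar decomposition of additive Haar
measure (`MeasureTheory.Measure.toSphere`, `Measure.volumeIoiPow`,
`Measure.measurePreserving_homeomorphUnitSphereProd`: `x ↦ (x/‖x‖, ‖x‖)` sends `μ` on `E ∖ {0}` to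
`μ.toSphere ⊗ r^{dim E − 1} dr`).  Nothing is cited as a fact.  Printed counterparts, NAMED ONLY:
the polar-coordinates formula (Folland, *Real Analysis* Thm 2.49); Muller 1959 / Marsaglia 1972
(a direction uniform on the sphere from a spherically symmetric vector).

This is the measure-theoretic core of the SU(2) heat-bath direction law
(`Exactness/SU2HeatBathLaw.lean`): for ANY weight that depends on the radius only, the direction
`x/‖x‖` is distributed by the normalised sphere measure and is INDEPENDENT of the radius.

## What is proved (`E` a nontrivial finite-dimensional real normed space with its Borel σ-algebra, `μ` an additive Haar measure)

* `map_withDensity_equiv` — pushing a weighted measure through a measurable equivalence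
  (bookkeeping used downstream).
* `dirSphere y : sphere 0 1` — the direction `y/‖y‖` (a fixed junk point at `y = 0`);
  `dirSphere_coe`, `dirSphere_smul` (invariant under positive rescaling), measurable
  (`measurable_dirSphere`, continuous off the origin).
* `lintegral_dirSphere_norm` — **polar coordinates**: for measurable `F` on `sphere × ℝ`,
  `∫ F(dirSphere y, ‖y‖) dμ(y) = ∫ F(s, r) d(μ.toSphere ⊗ volumeIoiPow (dim E − 1))(s, r)`.
* `uniformSphere μ = (μ.toSphere univ)⁻¹ • μ.toSphere` — the normalised sphere measure, a
  probability measure (`isProbabilityMeasure_uniformSphere`).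
* **`map_dirSphere_norm_radial`** — for a measurable radial weight `φ(‖y‖)` with
  `ν = φ(‖·‖) · μ` finite: `ν.map (y ↦ (dirSphere y, ‖y‖)) = uniformSphere μ ⊗ ν.map ‖·‖`; i.e.
  under any radially weighted Haar measure the direction is uniform on the sphere and independent
  of the radius; `map_dirSphere_radial`: its direction marginal is `ν(univ) • uniformSphere μ`.

NOT CLAIMED: non-radial weights; infinite `ν`; identification of `uniformSphere volume` with
Hausdorff measure (not needed).
-/

namespace Summit.Ventures.LatticeQCDFlow.Exactness

open MeasureTheory Measure Metric Set
open scoped ENNReal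

/-! ## §0 Bookkeeping: weights through measurable equivalences -/

section Equiv

variable {α β : Type*} [MeasurableSpace α] [MeasurableSpace β]

/-- Pushing a weighted measure through a measurable equivalence: `(g∘e · μ).map e = g · (μ.map e)`. -/
theorem map_withDensity_equiv (μ : Measure α) (e : α ≃ᵐ β) {g : β → ℝ≥0∞} (hg : Measurable g) :
    (μ.withDensity (g ∘ e)).map e = (μ.map e).withDensity g := by
  ext s hs
  rw [Measure.map_apply e.measurable hs, withDensity_apply _ (e.measurable hs), withDensity_apply _ hs,
    setLIntegral_map hs hg e.measurable]
  rfl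

end Equiv

/-! ## §1 The direction map -/

section Direction

variable {E : Type*} [NormedAddCommGroup E] [NormedSpace ℝ E] [Nontrivial E]

/-- A fixed point of the unit sphere (junk value of the direction at the origin). -/
noncomputable def sphereDefault : sphere (0 : E) 1 :=
  ⟨(NormedSpace.sphere_nonempty.2 zero_le_one).some, (NormedSpace.sphere_nonempty.2 zero_le_one).some_mem⟩

open Classical in
/-- **The direction** `y/‖y‖` of a vector, as a point of the unit sphere (junk at `y = 0`). -/
noncomputable def dirSphere (y : E) : sphere (0 : E) 1 :=
  if h : y = 0 then sphereDefault else
    ⟨‖y‖⁻¹ • y, by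
      rw [mem_sphere_zero_iff_norm, norm_smul, norm_inv, norm_norm,
        inv_mul_cancel₀ (norm_ne_zero_iff.2 h)]⟩

/-- Off the origin the direction is `‖y‖⁻¹ • y`. -/
theorem dirSphere_coe {y : E} (hy : y ≠ 0) : (dirSphere y : E) = ‖y‖⁻¹ • y := by
  rw [dirSphere, dif_neg hy]

/-- The direction is invariant under positive rescaling. -/
theorem dirSphere_smul {c : ℝ} (hc : 0 < c) (y : E) : dirSphere (c • y) = dirSphere y := by
  by_cases hy : y = 0
  · rw [hy, smul_zero]
  · have hcy : c • y ≠ 0 := smul_ne_zero hc.ne' hy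
    apply Subtype.ext
    rw [dirSphere_coe hcy, dirSphere_coe hy, norm_smul, Real.norm_of_nonneg hc.le, smul_smul]
    congr 1
    field_simp

/-- Off the origin the direction is the first component of Mathlib's polar homeomorphism. -/
theorem dirSphere_eq_homeomorph {y : E} (hy : y ≠ 0) :
    dirSphere y = (homeomorphUnitSphereProd E ⟨y, hy⟩).1 := by
  apply Subtype.ext
  rw [dirSphere_coe hy]
  simp

/-- The direction map is continuous off the origin. -/
theorem continuousOn_dirSphere : ContinuousOn (dirSphere : E → sphere (0 : E) 1) {0}ᶜ := by
  rw [continuousOn_iff_continuous_restrict]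
  have h : ({0}ᶜ : Set E).restrict (dirSphere : E → sphere (0 : E) 1) =
      fun z => (homeomorphUnitSphereProd E z).1 := by
    funext z
    exact dirSphere_eq_homeomorph (show (z : E) ≠ 0 from z.2)
  rw [h]
  exact (homeomorphUnitSphereProd E).continuous.fst

variable [MeasurableSpace E] [BorelSpace E]

/-- The direction map is measurable. -/
theorem measurable_dirSphere : Measurable (dirSphere : E → sphere (0 : E) 1) :=
  measurable_of_continuousOn_compl_singleton 0 continuousOn_dirSphere

/-- The pair (direction, radius) is measurable. -/
theorem measurable_dirSphere_norm : Measurable fun y : E => (dirSphere y, ‖y‖) :=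
  measurable_dirSphere.prodMk measurable_norm

end Direction

/-! ## §2 Polar coordinates and the factorisation -/

section Polar

variable {E : Type*} [NormedAddCommGroup E] [NormedSpace ℝ E] [Nontrivial E] [FiniteDimensional ℝ E]
  [MeasurableSpace E] [BorelSpace E] (μ : Measure E) [μ.IsAddHaarMeasure]

/-- **Polar coordinates** for an additive Haar measure: integrating a function of (direction, radius)
against `μ` is integrating it against `μ.toSphere ⊗ r^{dim E − 1} dr`. -/
theorem lintegral_dirSphere_norm {F : sphere (0 : E) 1 × ℝ → ℝ≥0∞} (hF : Measurable F) :
    ∫⁻ y, F (dirSphere y, ‖y‖) ∂μ =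
      ∫⁻ p, F (p.1, (p.2 : ℝ)) ∂(μ.toSphere.prod (volumeIoiPow (Module.finrank ℝ E - 1))) := by
  have h0 : ({0}ᶜ : Set E) =ᵐ[μ] (univ : Set E) := by
    rw [ae_eq_univ, compl_compl]
    exact measure_singleton 0
  have hG : Measurable fun p : sphere (0 : E) 1 × Ioi (0 : ℝ) => F (p.1, (p.2 : ℝ)) :=
    hF.comp (measurable_fst.prodMk (measurable_subtype_coe.comp measurable_snd))
  rw [← setLIntegral_univ, ← Measure.restrict_congr_set h0,
    ← lintegral_subtype_comap (measurableSet_singleton (0 : E)).compl,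
    ← (μ.measurePreserving_homeomorphUnitSphereProd).lintegral_comp hG]
  refine lintegral_congr fun z => ?_
  have hz : (z : E) ≠ 0 := z.2
  rw [dirSphere_eq_homeomorph hz]
  simp

/-- **The uniform probability measure on the unit sphere** (normalised `μ.toSphere`). -/
noncomputable def uniformSphere : Measure (sphere (0 : E) 1) :=
  (μ.toSphere univ)⁻¹ • μ.toSphere

/-- The total mass of `μ.toSphere` is neither zero nor infinite. -/
theorem toSphere_univ_ne_zero : μ.toSphere univ ≠ 0 := by
  rw [Ne, Measure.measure_univ_eq_zero]
  exact Measure.toSphere_ne_zero μ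

/-- `uniformSphere μ` is a probability measure. -/
instance isProbabilityMeasure_uniformSphere : IsProbabilityMeasure (uniformSphere μ) :=
  ⟨by rw [uniformSphere, Measure.smul_apply, smul_eq_mul,
    ENNReal.inv_mul_cancel (toSphere_univ_ne_zero μ) (measure_ne_top _ _)]⟩

variable {μ}

/-- The joint mass of a (direction, radius) rectangle under a radial weight factorises through the
sphere measure. -/
theorem radial_rectangle {φ : ℝ → ℝ≥0∞} (hφ : Measurable φ) {s : Set (sphere (0 : E) 1)}
    (hs : MeasurableSet s) {t : Set ℝ} (ht : MeasurableSet t) :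
    μ.withDensity (fun y => φ ‖y‖) ((fun y => (dirSphere y, ‖y‖)) ⁻¹' s ×ˢ t) =
      μ.toSphere s * ∫⁻ r, t.indicator φ (r : ℝ) ∂(volumeIoiPow (Module.finrank ℝ E - 1)) := by
  have hst : MeasurableSet ((fun y : E => (dirSphere y, ‖y‖)) ⁻¹' s ×ˢ t) :=
    measurable_dirSphere_norm (hs.prod ht)
  rw [withDensity_apply _ hst, ← lintegral_indicator hst]
  -- the integrand is a function of (direction, radius)
  have hF : Measurable fun p : sphere (0 : E) 1 × ℝ => (s ×ˢ t).indicator (fun q => φ q.2) p :=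
    (hφ.comp measurable_snd).indicator (hs.prod ht)
  have heq : (fun y : E => ((fun y => (dirSphere y, ‖y‖)) ⁻¹' s ×ˢ t).indicator (fun y => φ ‖y‖) y) =
      fun y => (s ×ˢ t).indicator (fun q : sphere (0 : E) 1 × ℝ => φ q.2) (dirSphere y, ‖y‖) := by
    funext y
    by_cases hy : (dirSphere y, ‖y‖) ∈ s ×ˢ t
    · rw [indicator_of_mem hy, indicator_of_mem (show y ∈ _ from hy)]
    · rw [indicator_of_notMem hy, indicator_of_notMem (show y ∉ _ from hy)]
  rw [heq, lintegral_dirSphere_norm μ hF]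
  have hprod : ∀ p : sphere (0 : E) 1 × Ioi (0 : ℝ),
      (s ×ˢ t).indicator (fun q : sphere (0 : E) 1 × ℝ => φ q.2) (p.1, (p.2 : ℝ)) =
        s.indicator 1 p.1 * t.indicator φ (p.2 : ℝ) := by
    intro p
    by_cases h1 : p.1 ∈ s <;> by_cases h2 : (p.2 : ℝ) ∈ t
    · rw [indicator_of_mem (show ((p.1, (p.2 : ℝ)) : sphere (0 : E) 1 × ℝ) ∈ s ×ˢ t from
        mem_prod.2 ⟨h1, h2⟩), indicator_of_mem h1, indicator_of_mem h2, Pi.one_apply, one_mul]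
    · rw [indicator_of_notMem (show ((p.1, (p.2 : ℝ)) : sphere (0 : E) 1 × ℝ) ∉ s ×ˢ t from
        fun h => h2 (mem_prod.1 h).2), indicator_of_notMem h2, mul_zero]
    · rw [indicator_of_notMem (show ((p.1, (p.2 : ℝ)) : sphere (0 : E) 1 × ℝ) ∉ s ×ˢ t from
        fun h => h1 (mem_prod.1 h).1), indicator_of_notMem h1, zero_mul]
    · rw [indicator_of_notMem (show ((p.1, (p.2 : ℝ)) : sphere (0 : E) 1 × ℝ) ∉ s ×ˢ t from
        fun h => h1 (mem_prod.1 h).1), indicator_of_notMem h1, zero_mul]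
  simp_rw [hprod]
  have hf : Measurable fun a : sphere (0 : E) 1 => s.indicator (1 : sphere (0 : E) 1 → ℝ≥0∞) a :=
    measurable_one.indicator hs
  have hg : Measurable fun r : Ioi (0 : ℝ) => t.indicator φ (r : ℝ) :=
    (hφ.indicator ht).comp measurable_subtype_coe
  rw [lintegral_prod_mul hf.aemeasurable hg.aemeasurable, lintegral_indicator_one hs]

/-- **Polar factorisation of a radially weighted Haar measure.**  For a measurable radial weight
`φ(‖y‖)` with `ν = φ(‖·‖) · μ` finite, the joint law of (direction, radius) under `ν` is the
PRODUCT of the uniform probability on the sphere and the radial law `ν.map ‖·‖`: the direction is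
uniform and independent of the radius. -/
theorem map_dirSphere_norm_radial {φ : ℝ → ℝ≥0∞} (hφ : Measurable φ)
    [IsFiniteMeasure (μ.withDensity fun y => φ ‖y‖)] :
    (μ.withDensity fun y => φ ‖y‖).map (fun y => (dirSphere y, ‖y‖)) =
      (uniformSphere μ).prod ((μ.withDensity fun y => φ ‖y‖).map fun y => ‖y‖) := by
  symm
  refine Measure.prod_eq fun s t hs ht => ?_
  rw [Measure.map_apply measurable_dirSphere_norm (hs.prod ht), radial_rectangle hφ hs ht,
    Measure.map_apply measurable_norm ht]
  have huniv := radial_rectangle (μ := μ) hφ MeasurableSet.univ ht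
  have hpre : (fun y : E => (dirSphere y, ‖y‖)) ⁻¹' (univ : Set (sphere (0 : E) 1)) ×ˢ t =
      (fun y : E => ‖y‖) ⁻¹' t := by
    ext y
    simp
  rw [hpre] at huniv
  rw [huniv, uniformSphere, Measure.smul_apply, smul_eq_mul, mul_mul_mul_comm,
    ENNReal.inv_mul_cancel (toSphere_univ_ne_zero μ) (measure_ne_top _ _), one_mul]

/-- **The direction of a radially weighted Haar measure is uniform on the sphere**:
`ν.map dirSphere = ν(univ) • uniformSphere μ`. -/
theorem map_dirSphere_radial {φ : ℝ → ℝ≥0∞} (hφ : Measurable φ)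
    [IsFiniteMeasure (μ.withDensity fun y => φ ‖y‖)] :
    (μ.withDensity fun y => φ ‖y‖).map dirSphere =
      (μ.withDensity fun y => φ ‖y‖) univ • uniformSphere μ := by
  ext s hs
  have h := congrArg (fun m : Measure (sphere (0 : E) 1 × ℝ) => m (s ×ˢ univ))
    (map_dirSphere_norm_radial (μ := μ) hφ)
  rw [Measure.map_apply measurable_dirSphere_norm (hs.prod MeasurableSet.univ), Measure.prod_prod,
    Measure.map_apply measurable_norm MeasurableSet.univ, preimage_univ] at h
  have hpre : (fun y : E => (dirSphere y, ‖y‖)) ⁻¹' s ×ˢ (univ : Set ℝ) = dirSphere ⁻¹' s := by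
    ext y
    simp
  rw [Measure.map_apply measurable_dirSphere hs, Measure.smul_apply, smul_eq_mul, ← hpre, h, mul_comm]

end Polar

end Summit.Ventures.LatticeQCDFlow.Exactness
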